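import Mathlib
import Summits.MatrixMultiplication.MatrixMultiplication.Theorems.SnSubsetDichotomyPolynomialSlackPositionKeptBound
import Summits.MatrixMultiplication.MatrixMultiplication.Theorems.SnSubsetDichotomyPolynomialSlackPositionRates

/-!
# The per-position kept bound, instantiated (no-win form)

Crux `Summit.MatrixMultiplication.MatrixMultiplication.Theses.SnSubsetDichotomy.PolynomialSlack`
(item `stmt-MatrixMultiplication-8306`), level-one programme, line transport-split-hull (lead c9),
programme B "atoms endgame", stub `position_kept_bound_inst` (HA1).

At a hub position `k` of `U` (TPP triple `S, T, U ⊆ S_n`, quotient profiles `dA, dB, dC`, kept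
profiles `pB, pC` above the thresholds `θB, θC ≥ 16/n`), the level-one kept value of the position,
`(n-1)((Σ_j pB)(Σ_i pC)/n - Σ_{i,j} dA pB pC)`, is the sum over the atoms `(a, b)` (pairs of dyadic
levels of `dB(·,k)` and `dC(k,·)`) of the pair kept values `c a b = (n-1)(σ a ρ b/n - Ψ a b)`.
Under the no-win hypothesis `W < N` the abstract per-position inequality `position_kept_bound`
applies to this data, with the hub masses `h a b = Σ_v μ_v X_a(v) Y_b(v)`, the depletion relation
`Ψ a b ≤ (1-ε₂) σ a ρ b/n` and `Lg = log n`: its win-free hypotheses are `atom_basic_facts`, its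
no-win hypotheses are `atom_noWin_facts` (penalty of small hub atoms, no depleted hub atom, small
area of depleted atoms) and the rate box `incl_rate_bounds`.  The result bounds the kept value by
`0.74 ×` the entropy cost of the included levels plus the slop
`ε₂ (Σσ')(Σρ') + 2 ε₁ m (Σσ' + Σρ') + 2 (Σσ' + Σρ') m² h₁`, `m = ⌊log₂ n²⌋₊ + 1`.
-/

namespace Summit.MatrixMultiplication.MatrixMultiplication.Theorems.PolynomialSlack

set_option linter.dupNamespace false

open scoped BigOperators
open Literature.Combinatorics.Additive (TripleProductProperty)

/-- **Per-position kept bound, instantiated (HA1, no-win form).** At a hub position `k`, under the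
no-win hypothesis `W < N` (`W` dominating the depleted-atom, small-hub-atom and pinned-block win
bounds), the level-one kept value `(n-1)((Σ_j pB)(Σ_i pC)/n - Σ dA pB pC)` of the position is at
most `0.74 ·` (entropy cost `Σ σ'(1 - log x/log n) + Σ ρ'(1 - log y/log n)` of the included
levels) `+ ε₂ (Σσ')(Σρ') + 2 ε₁ m (Σσ' + Σρ') + 2 (Σσ' + Σρ') m² h₁`.  Proof: write the kept
value as `Σ_{a,b} (n-1)(σ a ρ b/n - Ψ a b)` (`atom_basic_facts` (8)-(10)) and apply
`position_kept_bound` with the hub masses `h a b = Σ_v μ X_a Y_b`, `Dep a b ⇔ Ψ ≤ (1-ε₂)σρ/n`,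
`Lg = log n`; its hypotheses are `atom_basic_facts`, `atom_noWin_facts` and `incl_rate_bounds`. -/
theorem position_kept_bound_inst {n : ℕ} (hn : 2 ≤ n) (B : ℕ) (hB : ∀ S' T' U' : Finset (Equiv.Perm (Fin (n - 1))), TripleProductProperty S' T' U' → S'.card * T'.card * U'.card ≤ B) {S T U : Finset (Equiv.Perm (Fin n))} (hTPP : TripleProductProperty S T U) (hS0 : S.Nonempty) (hT0 : T.Nonempty) (hU0 : U.Nonempty) (dA dB dC pB pC : Fin n → Fin n → ℝ) (hdA : ∀ i j, dA i j = (((S ×ˢ T).filter fun st => st.2 j = st.1 i).card : ℝ) / (S.card * T.card : ℕ)) (hdB : ∀ j k, dB j k = (((T ×ˢ U).filter fun tu => tu.2 k = tu.1 j).card : ℝ) / (T.card * U.card : ℕ)) (hdC : ∀ k i, dC k i = (((U ×ˢ S).filter fun us => us.2 i = us.1 k).card : ℝ) / (U.card * S.card : ℕ)) (θB θC : ℝ) (hθB : 16 / (n : ℝ) ≤ θB) (hθC : 16 / (n : ℝ) ≤ θC) (hpB : ∀ j k, pB j k = if θB ≤ dB j k then dB j k - 1 / n else 0) (hpC : ∀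 k i, pC k i = if θC ≤ dC k i then dC k i - 1 / n else 0) (ε₁ ε₂ h₁ M A₀ P W : ℝ) (hε₁ : 0 < ε₁) (hε₂ : 0 < ε₂) (hε₂1 : ε₂ ≤ 1) (hh₁ : 0 < h₁) (hP0 : 0 ≤ P) (hM : 56 * (((⌊Real.logb 2 ((n : ℝ) ^ 2)⌋₊ + 1 : ℕ) : ℝ) * ((⌊Real.logb 2 ((n : ℝ) ^ 2)⌋₊ + 1 : ℕ) : ℝ)) ≤ M) (hA₀ : 5000 * n * (1 + Real.log n) * Real.log (4 * ((n.factorial : ℝ) / (S.card * T.card : ℕ)) / ε₂) / ε₂ ^ 2 ≤ A₀) (hA₀n : (n : ℝ) ≤ A₀) (hA₀log : Real.log A₀ ≤ 101 / 100 * Real.log n) (hPlow : A₀ ^ 2 * (n : ℝ) ^ (-(151 / 100 : ℝ)) ≤ P * ε₁ ^ 2) (hW : 10 ^ 7 * (1 + Real.log n) ^ 2 * (Real.log (4 * ((n.factorial : ℝ) / (S.card * T.card : ℕ)) / ε₂)) ^ 2 * n * B / (ε₂ ^ 4 * h₁ ^ 2) + 20 * (1 + M) * A₀ ^ 2 * B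 / (h₁ ^ 2 * n) + n * P * B ≤ W) (hN : W < ((S.card * T.card * U.card : ℕ) : ℝ)) (k : Fin n) (σ σ' x ρ ρ' y : Fin (⌊Real.logb 2 ((n : ℝ) ^ 2)⌋₊ + 1) → ℝ) (hσ : ∀ a, σ a = ∑ j ∈ Finset.univ.filter (fun j => θB ≤ dB j k ∧ ⌊Real.logb 2 (1 / dB j k)⌋₊ = a.val), pB j k) (hσ' : ∀ a, σ' a = ∑ j ∈ Finset.univ.filter (fun j => θB ≤ dB j k ∧ ⌊Real.logb 2 (1 / dB j k)⌋₊ = a.val), dB j k) (hx : ∀ a, x a = max (((Finset.univ.filter (fun j => θB ≤ dB j k ∧ ⌊Real.logb 2 (1 / dB j k)⌋₊ = a.val)).card : ℝ)) 1) (hρ : ∀ b, ρ b = ∑ i ∈ Finset.univ.filter (fun i => θC ≤ dC k i ∧ ⌊Real.logb 2 (1 / dC k i)⌋₊ = b.val), pC k i) (hρ' : ∀ b, ρ' b = ∑ i ∈ Finset.univ.filter (fun i => θC ≤ dC k i ∧ ⌊Real.logb 2 (1 / dC k i)⌋₊ = b.val), dC k i) (hy : ∀ b, y b = max (((Finset.univ.filter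 (fun i => θC ≤ dC k i ∧ ⌊Real.logb 2 (1 / dC k i)⌋₊ = b.val)).card : ℝ)) 1) (Ψ : Fin (⌊Real.logb 2 ((n : ℝ) ^ 2)⌋₊ + 1) → Fin (⌊Real.logb 2 ((n : ℝ) ^ 2)⌋₊ + 1) → ℝ) (hΨ : ∀ a b, Ψ a b = ∑ i ∈ Finset.univ.filter (fun i => θC ≤ dC k i ∧ ⌊Real.logb 2 (1 / dC k i)⌋₊ = b.val), ∑ j ∈ Finset.univ.filter (fun j => θB ≤ dB j k ∧ ⌊Real.logb 2 (1 / dB j k)⌋₊ = a.val), dA i j * pB j k * pC k i) : ((n : ℝ) - 1) * ((∑ j : Fin n, pB j k) * (∑ i : Fin n, pC k i) / n - ∑ i : Fin n, ∑ j : Fin n, dA i j * pB j k * pC k i) ≤ 74 / 100 * ((∑ a, if ε₁ ≤ σ a ∧ ∃ b, ε₁ ≤ ρ b ∧ Ψ a b ≤ (1 - ε₂) * (σ a * ρ b) / n then σ' a * (1 - Real.log (x a) / Real.log n) else 0) + (∑ b, if ε₁ ≤ ρ b ∧ ∃ a, ε₁ ≤ σ a ∧ Ψ a b ≤ (1 -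 ε₂) * (σ a * ρ b) / n then ρ' b * (1 - Real.log (y b) / Real.log n) else 0)) + (ε₂ * ((∑ a, σ' a) * (∑ b, ρ' b)) + 2 * ε₁ * ((⌊Real.logb 2 ((n : ℝ) ^ 2)⌋₊ + 1 : ℕ) : ℝ) * ((∑ a, σ' a) + (∑ b, ρ' b)) + 2 * ((∑ a, σ' a) + (∑ b, ρ' b)) * ((((⌊Real.logb 2 ((n : ℝ) ^ 2)⌋₊ + 1 : ℕ) : ℝ) * ((⌊Real.logb 2 ((n : ℝ) ^ 2)⌋₊ + 1 : ℕ) : ℝ)) * h₁)) := by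
  have hn0 : 0 < n := by omega
  have hnR : (0 : ℝ) < n := by exact_mod_cast hn0
  have hn2 : (2 : ℝ) ≤ n := by exact_mod_cast hn
  have hLg : 0 < Real.log n := Real.log_pos (by linarith)
  -- the hub masses of the atoms
  obtain ⟨h, hh⟩ : ∃ h : Fin (⌊Real.logb 2 ((n : ℝ) ^ 2)⌋₊ + 1) →
      Fin (⌊Real.logb 2 ((n : ℝ) ^ 2)⌋₊ + 1) → ℝ, ∀ a b, h a b =
        ∑ v : Fin n, ((U.filter fun u => u k = v).card : ℝ) / U.card *
          ((((T.filter fun t => t⁻¹ v ∈ Finset.univ.filter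
              (fun j => θB ≤ dB j k ∧ ⌊Real.logb 2 (1 / dB j k)⌋₊ = a.val)).card : ℝ) / T.card) *
            (((S.filter fun s => s⁻¹ v ∈ Finset.univ.filter
              (fun i => θC ≤ dC k i ∧ ⌊Real.logb 2 (1 / dC k i)⌋₊ = b.val)).card : ℝ) / S.card)) :=
    ⟨_, fun _ _ => rfl⟩
  -- the win-free bookkeeping (HA0), the no-win atom facts and the rate box (HA1b)
  obtain ⟨hσf, hρf, hh0, hhσ, hhρ, hbudget, hΨ0, hsB, hsC, hsA⟩ := atom_basic_facts hn hS0 hT0 hU0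
    dA dB dC pB pC hdA hdB hdC θB θC hθB hθC hpB hpC k σ σ' ρ ρ' hσ hσ' hρ hρ' h Ψ hh hΨ
  have hAF := fun a b => atom_noWin_facts hn B hB hTPP hS0 hT0 hU0 dA dB dC pB pC hdA hdB hdC θB θC
    hθB hθC hpB hpC ε₁ ε₂ h₁ M A₀ P W hε₁ hε₂ hε₂1 hh₁ hP0 hM hA₀ hA₀n hPlow hW hN k σ σ' x ρ ρ' y
    hσ hσ' hx hρ hρ' hy Ψ hΨ a b
  obtain ⟨hratex, hratey⟩ := incl_rate_bounds hn B hB hTPP hS0 hT0 hU0 dA dB dC pB pC hdA hdB hdC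
    θB θC hθB hθC hpB hpC ε₁ ε₂ h₁ M A₀ P W hε₁ hε₂ hε₂1 hh₁ hP0 hM hA₀ hA₀n hA₀log hPlow hW hN k σ
    σ' x ρ ρ' y hσ hσ' hx hρ hρ' hy Ψ hΨ
  -- the kept value of the position is the sum of the pair kept values
  have hLHS : ((n : ℝ) - 1) * ((∑ j : Fin n, pB j k) * (∑ i : Fin n, pC k i) / n -
      ∑ i : Fin n, ∑ j : Fin n, dA i j * pB j k * pC k i) =
        ∑ a, ∑ b, ((n : ℝ) - 1) * (σ a * ρ b / n - Ψ a b) := by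
    rw [hsB, hsC, hsA, Finset.sum_mul_sum, Finset.sum_div, ← Finset.sum_sub_distrib,
      Finset.mul_sum]
    refine Finset.sum_congr rfl fun a _ => ?_
    rw [Finset.sum_div, ← Finset.sum_sub_distrib, Finset.mul_sum]
  rw [hLHS]
  -- the pair kept values: `c ≤ σ' ρ'` and `c ≤ ε₂ σ ρ` off the depleted pairs
  have hfrac : ((n : ℝ) - 1) / n ≤ 1 := by
    rw [div_le_one hnR]
    linarith
  have hc : ∀ a b, ((n : ℝ) - 1) * (σ a * ρ b / n - Ψ a b) ≤ σ' a * ρ' b := by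
    intro a b
    obtain ⟨hσ0, hσle, -⟩ := hσf a
    obtain ⟨hρ0, hρle, -⟩ := hρf b
    have hsr : 0 ≤ σ a * ρ b := mul_nonneg hσ0 hρ0
    have h1 : σ a * ρ b ≤ σ' a * ρ' b := mul_le_mul hσle hρle hρ0 (hσ0.trans hσle)
    have h2 : σ a * ρ b * (((n : ℝ) - 1) / n) ≤ σ a * ρ b := mul_le_of_le_one_right hsr hfrac
    have h3 : 0 ≤ ((n : ℝ) - 1) * Ψ a b := mul_nonneg (by linarith) (hΨ0 a b)
    have e : ((n : ℝ) - 1) * (σ a * ρ b / n - Ψ a b) =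
        σ a * ρ b * (((n : ℝ) - 1) / n) - ((n : ℝ) - 1) * Ψ a b := by ring
    rw [e]
    linarith
  have hcdep : ∀ a b, ¬ (Ψ a b ≤ (1 - ε₂) * (σ a * ρ b) / n) →
      ((n : ℝ) - 1) * (σ a * ρ b / n - Ψ a b) ≤ ε₂ * σ a * ρ b := by
    intro a b hd
    have hd' := not_le.1 hd
    have hsr : 0 ≤ σ a * ρ b := mul_nonneg (hσf a).1 (hρf b).1
    have hn1 : (0 : ℝ) ≤ (n : ℝ) - 1 := by linarith
    have h1 : σ a * ρ b / n - Ψ a b ≤ ε₂ * (σ a * ρ b) / n := by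
      have : (1 - ε₂) * (σ a * ρ b) / n = σ a * ρ b / n - ε₂ * (σ a * ρ b) / n := by ring
      linarith
    have h2 : ((n : ℝ) - 1) * (σ a * ρ b / n - Ψ a b) ≤ ((n : ℝ) - 1) * (ε₂ * (σ a * ρ b) / n) :=
      mul_le_mul_of_nonneg_left h1 hn1
    have h3 : ((n : ℝ) - 1) * (ε₂ * (σ a * ρ b) / n) = ε₂ * σ a * ρ b * (((n : ℝ) - 1) / n) := by
      ring
    have h4 : ε₂ * σ a * ρ b * (((n : ℝ) - 1) / n) ≤ ε₂ * σ a * ρ b :=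
      mul_le_of_le_one_right (by rw [mul_assoc]; exact mul_nonneg hε₂.le hsr) hfrac
    linarith
  have hx1 : ∀ a, 1 ≤ x a := fun a => by rw [hx]; exact le_max_right _ _
  have hy1 : ∀ b, 1 ≤ y b := fun b => by rw [hy]; exact le_max_right _ _
  -- the abstract per-position inequality
  exact position_kept_bound σ σ' x ρ ρ' y h (fun a b => ((n : ℝ) - 1) * (σ a * ρ b / n - Ψ a b))
    (fun a b => Ψ a b ≤ (1 - ε₂) * (σ a * ρ b) / n) ε₁ ε₂ h₁ M A₀ (Real.log n) hε₁ hε₂ hh₁ hLg hM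
    hA₀log hx1 hy1 hσf hρf hh0 hhσ hhρ hbudget hc hcdep
    (fun a b _ _ hle hs => (hAF a b).2.2.2.2 (hle.trans_eq (hh a b)) hs)
    (fun a b _ _ hd => (hh a b).trans_lt ((hAF a b).2.2.2.1 hd)) (fun a b hd => (hAF a b).2.2.1 hd)
    (fun a ha hb => hratex a ⟨ha, hb⟩) (fun b hb ha => hratey b ⟨hb, ha⟩)

end Summit.MatrixMultiplication.MatrixMultiplication.Theorems.PolynomialSlack
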